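import Summits.HodgeConjecture.HodgeConjecture.Theorems.F0P3cCohClassRoutingCotOfS2Fin   -- ★ `cohClassRoutingCot(Closed)_of_s2Fin` (re-threaded here) + ★ `…OfS2Sharp`: `kcTrivial_of_isCot`, `cotSpherical`, `localRouting`; ★ `F0P3CohClassRoutingCot` texts; ★ #80
import HarnessLib

/-!
# Crux `H413`, THREAD-₃ link (4) — the closer's `stub_L3` type in the TWO-COMPACT-PLACE FRAME: `CohClassRoutingCotClosed₃`, its Old → New, and its heads from
# ORGAN FIN₃ (and from S2♯₃), texts inline

Cell `hodgecm-mathlib`, R90-TF slab S5 «Ch13.3 mult∕rigidity» seat R90-C133-p01 (g2), deal (H18) of the S5 dealer R90-C133-plan (g3) (2026-09-05T02:11:10Z) under RULING S5-R19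
«₃ TWINS LIVE SUMMITS-SIDE» (review of p864417: a `3 ≤ [L⁺:ℚ]` twin of a booked letter is a ROUTE restriction, not a new cited fact — it lives next to its consumers, never in
`Literature/`); crux item `stmt-HodgeConjecture-24833` (h413); `--supports stmt-HodgeConjecture-24833 --as helper`.  DEFINITION lane: ONE closed-header `def … : Prop` WITH BODY
(the ∀-closure text a skeleton would register `stub_L3₃` against) + theorems; no instance declaration, no notation, no named-fact hypothesis, no `sorry`; never imports a
`Cruxes/…/Lines` module (the letters FIN₃ ∕ S2♯₃ enter as hypothesis TEXTS, token for token the bodies of the LH1 leaf's forthcoming `S2FinLetter₃` ∕ `S2SharpLetter₃` =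
★ `F0P3cCohClassRoutingCotOfS2Fin` :124–:147 ∕ ★ #80 `cohDiscrete_memXiFamily_archPinned` :100–:122 with ONE inserted line `3 ≤ Module.finrank ℚ ↥(maximalRealSubfield L) →`
after the kept `2 ≤ …` line).  HONEST LABEL: this file pays NOTHING — HC_CM is proved only modulo the 7 printed citations (2 remaining named inputs: hLiu418 =
stmt-HodgeConjecture-24832, h413 = stmt-HodgeConjecture-24833) until rung 0 closes; the ₃ road is consumed only once the closer ∕ KitD ∕ AGG editions import these names.

WHY A ₃ EDITION.  The R90-TF road pays the finite-place organ FIN of #80's pay-down line from the Arthur-simple trace formula, which needs TWO compact real places of the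
definite unitary group, i.e. `3 ≤ [L⁺:ℚ]` (one place carries `U(2,1)`); the summit's frame has `6 ≤ [F:ℚ]` [Liu 2021, Prop. 4.13], so the restriction costs nothing
upstairs, but every letter on the path `FIN → stub_L3 → rung 0` must carry the extra hypothesis.  CONVENTION OF RECORD (S5-R19; tree `R90_S5_BaseChangeSpineA` :221–:226):
a ₃ twin = the Old body VERBATIM + one inserted line (diff = 2 lines: the name and that line); consumers pass `h2 h3` positionally; Old → New is a one-line monotonicity.

* §1 `CohClassRoutingCotClosed₃` — ★ `F0P3CohClassRoutingCot.CohClassRoutingCotClosed` (:101) body VERBATIM + the ONE `3 ≤ …` line; `cohClassRoutingCotClosed₃_of_closed`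
  (Old → New); `cohClassRoutingCot_of_closed₃` (read-back at a frame with `3 ≤ [L⁺:ℚ]`: the one-frame guarded letter ★ `CohClassRoutingCot`).
* §2 FROM ORGAN FIN₃ — `cohClassRoutingCot_of_s2Fin₃` (one frame) and HEAD `cohClassRoutingCotClosed₃_of_s2Fin₃ : ‹S2FinLetter₃ text› → CohClassRoutingCotClosed₃`
  (re-thread of ★ `cohClassRoutingCotClosed_of_s2Fin` :123: the source proof consumes FIN at exactly ONE frame, :113, so `h3` is threaded at that one call).
* §3 FROM S2♯₃ — `cohClassRoutingCot_of_s2sharp₃` and HEAD `cohClassRoutingCotClosed₃_of_s2sharp₃ : ‹S2SharpLetter₃ text› → CohClassRoutingCotClosed₃` (re-thread of ★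
  `cohClassRoutingCotClosed_of_s2sharp` :134, whose proof consumes S2♯ at ONE frame, :127, through READ-BACK 1 `.memXiFamily`; here the pin conjunct is dropped by `.1`).
  Either head serves the F0P3 owners' choice for the AGG edition (register `stub_S2fin₃` — the shorter «FIN₃ → L3₃» road — or keep `stub_S2sharp₃`).  Axioms = TRIO.

References: [Rogawski1990] J. Rogawski, *Automorphic Representations of Unitary Groups in Three Variables*, Ann. of Math. Stud. 123 (1990): §15.3 ¶1 (p. 249),
Thm. 13.3.6 (c) (p. 202), §14.6 Thm. 14.6.4 (p. 243), §13.1 p. 199, §12.2 (2) p. 174, §4.8 p. 51; [FlathCorvallis1979] D. Flath, *Decomposition of representations into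
tensor products*, Proc. Sympos. Pure Math. 33.1 (1979), Thm. 3; [Liu2021] Y. Liu, *Fourier–Jacobi cycles and arithmetic relative trace formula*, Prop. 4.13 (the `6 ≤ [F:ℚ]` frame).
-/

-- Mathlib idiom (as in ★ `F0P3CohClassRoutingCot`, ★ `F0P3cCohClassRoutingCotOfS2Fin`, ★ #80): the commutator bracket on `Module.End ℂ M`, needed to MENTION
-- `(uFormGroup (Fin 2) (Fin 1)).lie →ₗ⁅ℝ⁆ Module.End ℂ M` in the FIN₃ ∕ S2♯₃ texts (hypotheses token for token; no Lines import is allowed).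
attribute [local instance 100] LieRing.ofAssociativeRing

set_option autoImplicit false
-- the mandated namespace repeats `HodgeConjecture.HodgeConjecture`, as in every `Theorems/*.lean` of this sub-problem
set_option linter.dupNamespace false

noncomputable section

open NumberField IsDedekindDomain MeasureTheory Filter
open Literature.NumberTheory.Rogawski1990 Literature.NumberTheory.GaloisRepresentations
open Literature.NumberTheory.Automorphic Literature.NumberTheory.Automorphic.UnitaryGroup
open Literature.NumberTheory.Automorphic.UnitaryGroup.CotangentForms
open Literature.RepresentationTheory.BorelWallach2000 Literature.RepresentationTheory.KonnoKonno2007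
open Literature.RepresentationTheory.KonnoKonno2007.RealDualPair Literature.RepresentationTheory.KonnoKonno2007.RealDualPair.UForm
open scoped Matrix Classical ComplexOrder

namespace Summit.HodgeConjecture.HodgeConjecture.Cruxes.H413.F0P3cCohClassRoutingCotClosed3

open Summit.HodgeConjecture.HodgeConjecture.Cruxes.H413.F0P3InnerFormClassificationV6
open Summit.HodgeConjecture.HodgeConjecture.Cruxes.H413.F0P3ClassTokenChoice (clFinChoice admUnitConstituents)
open Summit.HodgeConjecture.HodgeConjecture.Cruxes.H413.F0P3CohClassRoutingCot (RoutesAt CohClassRoutingCot CohClassRoutingCotClosed)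
open Summit.HodgeConjecture.HodgeConjecture.Cruxes.H413.F0P3CohClassRoutingCotOfS2Sharp (kcTrivial_of_isCot cotSpherical localRouting)

/-! ## §1 The closed guarded routing letter in the two-compact-place frame, its Old → New, its read-back -/

/-- **`CohClassRoutingCotClosed₃` — the closer's `stub_L3` type, TWO-PLACE EDITION**: ★ `F0P3CohClassRoutingCot.CohClassRoutingCotClosed` (:101) body VERBATIM with ONE
extra hypothesis line `3 ≤ Module.finrank ℚ ↥(maximalRealSubfield L) →` after the kept `2 ≤ …` clause — the ∀-closure of the guarded letter ★ `CohClassRoutingCot` over the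
closer's frames that have at least two compact real places.  The `3 ≤` clause is a ROUTE restriction of the R90-TF road (Arthur-simple trace formula), NOT a hypothesis of
Rogawski's §15.3; the summit frame has `6 ≤ [F:ℚ]`.  Source: Rogawski 1990, §15.3 ¶1 and §4.8 p. 51 (no `cite` tag on a closed-header `def` in a Theorems file, D246 — the
tags are carried by the theorems below). -/
def CohClassRoutingCotClosed₃ : Prop :=
  ∀ (L : Type) [Field L] [NumberField L] [IsCMField L] (ι : L →+* ℂ) (H : Matrix (Fin 3) (Fin 3) L) (T : GL (Fin 3) ℂ)
    (hT : (T : Matrix (Fin 3) (Fin 3) ℂ)ᴴ * H.map ι * (T : Matrix (Fin 3) (Fin 3) ℂ) = Literature.Geometry.ComplexHyperbolic.BallModel.J)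
    (hH : (H.map (cmConjRingHom L))ᵀ = H) (hHd : IsUnit H.det),
    (∀ τ' : L →+* ℂ, InfinitePlace.mk τ' ≠ InfinitePlace.mk ι → (H.map τ').PosDef) → 2 ≤ Module.finrank ℚ ↥(maximalRealSubfield L) →
    3 ≤ Module.finrank ℚ ↥(maximalRealSubfield L) →
    ∀ (μ : Measure (Gp L H).automorphicQuotient) [(Gp L H).IsAutomorphicMeasure μ] (μω : HeckeCharacter L) (hμu : μω.IsUnitary),
    (∀ x : Literature.NumberTheory.GaloisRepresentations.ideleGroup ↥(maximalRealSubfield L), μω (AdeleRing.ideleBaseChange (↥(maximalRealSubfield L)) L x) = quadraticHeckeCharCM L x) →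
    ∀ [∀ v : HeightOneSpectrum (𝓞 ↥(maximalRealSubfield L)), MeasurableSpace (Gqs L v ⧸ Subgroup.center (Gqs L v))]
      [∀ v : HeightOneSpectrum (𝓞 ↥(maximalRealSubfield L)), BorelSpace (Gqs L v ⧸ Subgroup.center (Gqs L v))]
      (μZ : ∀ v : HeightOneSpectrum (𝓞 ↥(maximalRealSubfield L)), Measure (Gqs L v ⧸ Subgroup.center (Gqs L v)))
      [∀ v : HeightOneSpectrum (𝓞 ↥(maximalRealSubfield L)), (μZ v).IsHaarMeasure]
      (keys : ∀ (ξ : OneDimAutRepH L) (v : HeightOneSpectrum (𝓞 ↥(maximalRealSubfield L))),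
        (∀ w : PlacesOver L v, IsCMField.complexConj L • w.1 = w.1) →
          {p : IrrClass (Gqs L v) × IrrClass (Gqs L v) //
            KeysCaseTwoLabels L v (μω.semilocalComponent L v) (torusLocalComponent L (IsCMField.complexConj L) v ξ.η)
              (torusLocalComponent L (IsCMField.complexConj L) v ξ.ψ) p.1 p.2 ∧
            p.1.IsSquareIntegrable (μZ v) ∧ ¬ p.2.IsSquareIntegrable (μZ v)}),
    CohClassRoutingCot L H hH hHd μω hμu μZ keys ι T hT μ

/-- Old → New MONOTONICITY: the closed guarded letter implies its two-place twin (the extra hypothesis is dropped). Pure logic. [cite: Rogawski1990, §15.3 ¶1 (p. 249)] -/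
theorem cohClassRoutingCotClosed₃_of_closed (h : CohClassRoutingCotClosed) : CohClassRoutingCotClosed₃ :=
  fun L _ _ _ ι H T hT hH hHd hdef h2 _h3 μ _ μω hμu hμω _ _ μZ _ keys => h L ι H T hT hH hHd hdef h2 μ μω hμu hμω μZ keys

variable (L : Type) [Field L] [NumberField L] [IsCMField L] (H : Matrix (Fin 3) (Fin 3) L)
  (hH : (H.map (cmConjRingHom L))ᵀ = H) (hHd : IsUnit H.det) (μω : HeckeCharacter L) (hμu : μω.IsUnitary)
  [∀ v : HeightOneSpectrum (𝓞 ↥(maximalRealSubfield L)), MeasurableSpace (Gqs L v ⧸ Subgroup.center (Gqs L v))]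
  (μZ : ∀ v : HeightOneSpectrum (𝓞 ↥(maximalRealSubfield L)), Measure (Gqs L v ⧸ Subgroup.center (Gqs L v)))
  (keys : ∀ (ξ : OneDimAutRepH L) (v : HeightOneSpectrum (𝓞 ↥(maximalRealSubfield L))),
    (∀ w : PlacesOver L v, IsCMField.complexConj L • w.1 = w.1) →
      {p : IrrClass (Gqs L v) × IrrClass (Gqs L v) //
        KeysCaseTwoLabels L v (μω.semilocalComponent L v) (torusLocalComponent L (IsCMField.complexConj L) v ξ.η)
          (torusLocalComponent L (IsCMField.complexConj L) v ξ.ψ) p.1 p.2 ∧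
        p.1.IsSquareIntegrable (μZ v) ∧ ¬ p.2.IsSquareIntegrable (μZ v)})
  (ι : L →+* ℂ) (T : GL (Fin 3) ℂ)
  (hT : (T : Matrix (Fin 3) (Fin 3) ℂ)ᴴ * H.map ι * (T : Matrix (Fin 3) (Fin 3) ℂ) = Literature.Geometry.ComplexHyperbolic.BallModel.J)
  (μ : Measure (Gp L H).automorphicQuotient) [(Gp L H).IsAutomorphicMeasure μ]

/-- READ-BACK at one frame with `3 ≤ [L⁺:ℚ]`: the two-place closed letter yields the one-frame guarded letter ★ `CohClassRoutingCot` (what the rung-0 kit reads per frame).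
[cite: Rogawski1990, §15.3 ¶1 (p. 249); Thm. 13.3.6 (c) (p. 202)] -/
theorem cohClassRoutingCot_of_closed₃ [∀ v : HeightOneSpectrum (𝓞 ↥(maximalRealSubfield L)), BorelSpace (Gqs L v ⧸ Subgroup.center (Gqs L v))]
    [∀ v : HeightOneSpectrum (𝓞 ↥(maximalRealSubfield L)), (μZ v).IsHaarMeasure] (h : CohClassRoutingCotClosed₃)
    (hdef : ∀ τ' : L →+* ℂ, InfinitePlace.mk τ' ≠ InfinitePlace.mk ι → (H.map τ').PosDef) (h2 : 2 ≤ Module.finrank ℚ ↥(maximalRealSubfield L))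
    (h3 : 3 ≤ Module.finrank ℚ ↥(maximalRealSubfield L))
    (hμω : ∀ x : Literature.NumberTheory.GaloisRepresentations.ideleGroup ↥(maximalRealSubfield L),
      μω (AdeleRing.ideleBaseChange (↥(maximalRealSubfield L)) L x) = quadraticHeckeCharCM L x) :
    CohClassRoutingCot L H hH hHd μω hμu μZ keys ι T hT μ :=
  h L ι H T hT hH hHd hdef h2 h3 μ μω hμu hμω μZ keys

/-! ## §2 FROM ORGAN FIN₃ (the text of the LH1 leaf's `S2FinLetter₃`, token for token) -/

/-- **`CohClassRoutingCot` FROM ORGAN FIN₃ (one frame with `3 ≤ [L⁺:ℚ]`).**  Hypothesis `hFin₃` = the text of the LEAF's `S2FinLetter₃` token for token (= ★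
`cohClassRoutingCot_of_s2Fin`'s `hFin` with ONE inserted line `3 ≤ …` after `2 ≤ …`).  Proof = ★ `cohClassRoutingCot_of_s2Fin` :111–:115 re-threaded: FIN₃ is consumed at
exactly ONE frame (`hdef h2 h3`), `K_c`-triviality of a cotangent `P` is ★ `kcTrivial_of_isCot`, the cofinite spherical constituent ★ `cotSpherical` (an `h2` fact), the routing
★ `localRouting`.  PRINT behind FIN (rung 5): a cotangent `P` is of type `Π′(ξ)` for a one-dimensional `ξ`; the `3 ≤` clause is a ROUTE restriction, not Rogawski's.
[cite: Rogawski1990, §15.3 ¶1 (p. 249); Thm. 13.3.6 (c) (p. 202); §14.6 Thm. 14.6.4 (p. 243); §13.1 p. 199; §12.2 (2) p. 174] [cite: FlathCorvallis1979, Thm. 3] -/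
theorem cohClassRoutingCot_of_s2Fin₃ [∀ v : HeightOneSpectrum (𝓞 ↥(maximalRealSubfield L)), BorelSpace (Gqs L v ⧸ Subgroup.center (Gqs L v))]
    [∀ v : HeightOneSpectrum (𝓞 ↥(maximalRealSubfield L)), (μZ v).IsHaarMeasure]
    (hFin₃ : ∀ (L : Type) [Field L] [NumberField L] [IsCMField L] (ι : L →+* ℂ) (H : Matrix (Fin 3) (Fin 3) L) (T : GL (Fin 3) ℂ)
      (hT : (T : Matrix (Fin 3) (Fin 3) ℂ)ᴴ * H.map ι * (T : Matrix (Fin 3) (Fin 3) ℂ) = Literature.Geometry.ComplexHyperbolic.BallModel.J),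
      (∀ τ' : L →+* ℂ, InfinitePlace.mk τ' ≠ InfinitePlace.mk ι → (H.map τ').PosDef) →
      2 ≤ Module.finrank ℚ ↥(maximalRealSubfield L) →
      3 ≤ Module.finrank ℚ ↥(maximalRealSubfield L) →
      ∀ (μ : Measure (adelicGroupData (↥(maximalRealSubfield L)) L (IsCMField.complexConj L) 3 H).automorphicQuotient)
        [(adelicGroupData (↥(maximalRealSubfield L)) L (IsCMField.complexConj L) 3 H).IsAutomorphicMeasure μ]
        (μω : HeckeCharacter L) (hμu : μω.IsUnitary),
        (∀ x : Literature.NumberTheory.GaloisRepresentations.ideleGroup ↥(maximalRealSubfield L),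
          μω (AdeleRing.ideleBaseChange (↥(maximalRealSubfield L)) L x) = quadraticHeckeCharCM L x) →
      ∀ (P : DiscreteAutomorphicRep (adelicGroupData (↥(maximalRealSubfield L)) L (IsCMField.complexConj L) 3 H) μ),
        (P.IsHolCotangentAt (cmArchSection L ι H T hT) (cmCompactFactor L ι H T hT) ∨
          P.IsAntiholCotangentAt (cmArchSection L ι H T hT) (cmCompactFactor L ι H T hT)) →
        (∀ k : (adelicGroupData (↥(maximalRealSubfield L)) L (IsCMField.complexConj L) 3 H).Adelic, k ∈ cmCompactFactor L ι H T hT →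
          ∀ v : P.space.toSubmodule, (adelicGroupData (↥(maximalRealSubfield L)) L (IsCMField.complexConj L) 3 H).rightRegular μ k
            (v : (adelicGroupData (↥(maximalRealSubfield L)) L (IsCMField.complexConj L) 3 H).L2 μ) = v) →
        ∀ (M : Type) [AddCommGroup M] [Module ℂ M]
          (σK : Representation ℂ (uFormGroup (Fin 2) (Fin 1)).maximalCompact M) (σ𝔤 : (uFormGroup (Fin 2) (Fin 1)).lie →ₗ⁅ℝ⁆ Module.End ℂ M)
          (hM : IsGKModule (uFormGroup (Fin 2) (Fin 1)) σK σ𝔤), IsIrreducibleGK σK σ𝔤 →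
          (∃ T₁ : P.archModuleCM ι T hT →ₗ[ℂ] M,
            (∀ (k : (uFormGroup (Fin 2) (Fin 1)).maximalCompact) (w : P.archModuleCM ι T hT), T₁ (P.archRepKCM ι T hT k w) = σK k (T₁ w)) ∧
              (∀ (X : (uFormGroup (Fin 2) (Fin 1)).lie) (w : P.archModuleCM ι T hT), T₁ (P.archRepLieCM ι T hT X w) = σ𝔤 X (T₁ w)) ∧ T₁ ≠ 0) →
          ∀ δ : ℤ, (δ = 1 ∨ δ = -1) → upqTypeClasses σK σ𝔤 hM.ad_compat 1 δ ≠ ⊥ →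
            ∃ ξ : OneDimAutRepH L,
              MemXiFamily P (transpose_map_cmConjRingHom_eq_of_frame L ι H T hT) (isUnit_det_of_frame L ι H T hT) μω hμu ξ)
    (hdef : ∀ τ' : L →+* ℂ, InfinitePlace.mk τ' ≠ InfinitePlace.mk ι → (H.map τ').PosDef) (h2 : 2 ≤ Module.finrank ℚ ↥(maximalRealSubfield L))
    (h3 : 3 ≤ Module.finrank ℚ ↥(maximalRealSubfield L))
    (hμω : ∀ x : Literature.NumberTheory.GaloisRepresentations.ideleGroup ↥(maximalRealSubfield L),
      μω (AdeleRing.ideleBaseChange (↥(maximalRealSubfield L)) L x) = quadraticHeckeCharCM L x) :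
    CohClassRoutingCot L H hH hHd μω hμu μZ keys ι T hT μ := by
  intro P hP M _ _ σK σ𝔤 hM hirr htok δ hδ hne
  -- ORGAN FIN₃ at the ONE frame `hdef h2 h3`, fed the `K_c`-triviality of a cotangent `P` (★ `kcTrivial_of_isCot`): `∃ ξ, MemXiFamily P … ξ`
  obtain ⟨ξ, hmem⟩ := hFin₃ L ι H T hT hdef h2 h3 μ μω hμu hμω P hP (kcTrivial_of_isCot L H ι T hT μ P hP) M σK σ𝔤 hM hirr htok δ hδ hne
  -- the cofinite spherical constituent of a cotangent `P` (★ `cotSpherical`, an `h2` fact) and the local routing glue (★ `localRouting`)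
  exact ⟨ξ, localRouting L H hH hHd μω hμu μZ keys μ P ξ hmem (cotSpherical L H ι T hT μ hdef h2 P hP)⟩

/-- **HEAD — `CohClassRoutingCotClosed₃` FROM ORGAN FIN₃ ALONE** (the shorter «FIN₃ → L3₃» road: no archimedean pin organ is consumed).  Hypothesis = the LEAF's `S2FinLetter₃`
text token for token; conclusion = the two-place closed guarded routing letter.  Re-thread of ★ `cohClassRoutingCotClosed_of_s2Fin` (:149) with `h3` passed positionally after
`h2`.  Axioms = TRIO (FIN₃ is a hypothesis here, not a `sorry`). [cite: Rogawski1990, §15.3 ¶1 (p. 249); Thm. 13.3.6 (c) (p. 202); §14.6 Thm. 14.6.4 (p. 243)] [cite: FlathCorvallis1979, Thm. 3] -/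
theorem cohClassRoutingCotClosed₃_of_s2Fin₃
    (hFin₃ : ∀ (L : Type) [Field L] [NumberField L] [IsCMField L] (ι : L →+* ℂ) (H : Matrix (Fin 3) (Fin 3) L) (T : GL (Fin 3) ℂ)
      (hT : (T : Matrix (Fin 3) (Fin 3) ℂ)ᴴ * H.map ι * (T : Matrix (Fin 3) (Fin 3) ℂ) = Literature.Geometry.ComplexHyperbolic.BallModel.J),
      (∀ τ' : L →+* ℂ, InfinitePlace.mk τ' ≠ InfinitePlace.mk ι → (H.map τ').PosDef) →
      2 ≤ Module.finrank ℚ ↥(maximalRealSubfield L) →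
      3 ≤ Module.finrank ℚ ↥(maximalRealSubfield L) →
      ∀ (μ : Measure (adelicGroupData (↥(maximalRealSubfield L)) L (IsCMField.complexConj L) 3 H).automorphicQuotient)
        [(adelicGroupData (↥(maximalRealSubfield L)) L (IsCMField.complexConj L) 3 H).IsAutomorphicMeasure μ]
        (μω : HeckeCharacter L) (hμu : μω.IsUnitary),
        (∀ x : Literature.NumberTheory.GaloisRepresentations.ideleGroup ↥(maximalRealSubfield L),
          μω (AdeleRing.ideleBaseChange (↥(maximalRealSubfield L)) L x) = quadraticHeckeCharCM L x) →
      ∀ (P : DiscreteAutomorphicRep (adelicGroupData (↥(maximalRealSubfield L)) L (IsCMField.complexConj L) 3 H) μ),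
        (P.IsHolCotangentAt (cmArchSection L ι H T hT) (cmCompactFactor L ι H T hT) ∨
          P.IsAntiholCotangentAt (cmArchSection L ι H T hT) (cmCompactFactor L ι H T hT)) →
        (∀ k : (adelicGroupData (↥(maximalRealSubfield L)) L (IsCMField.complexConj L) 3 H).Adelic, k ∈ cmCompactFactor L ι H T hT →
          ∀ v : P.space.toSubmodule, (adelicGroupData (↥(maximalRealSubfield L)) L (IsCMField.complexConj L) 3 H).rightRegular μ k
            (v : (adelicGroupData (↥(maximalRealSubfield L)) L (IsCMField.complexConj L) 3 H).L2 μ) = v) →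
        ∀ (M : Type) [AddCommGroup M] [Module ℂ M]
          (σK : Representation ℂ (uFormGroup (Fin 2) (Fin 1)).maximalCompact M) (σ𝔤 : (uFormGroup (Fin 2) (Fin 1)).lie →ₗ⁅ℝ⁆ Module.End ℂ M)
          (hM : IsGKModule (uFormGroup (Fin 2) (Fin 1)) σK σ𝔤), IsIrreducibleGK σK σ𝔤 →
          (∃ T₁ : P.archModuleCM ι T hT →ₗ[ℂ] M,
            (∀ (k : (uFormGroup (Fin 2) (Fin 1)).maximalCompact) (w : P.archModuleCM ι T hT), T₁ (P.archRepKCM ι T hT k w) = σK k (T₁ w)) ∧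
              (∀ (X : (uFormGroup (Fin 2) (Fin 1)).lie) (w : P.archModuleCM ι T hT), T₁ (P.archRepLieCM ι T hT X w) = σ𝔤 X (T₁ w)) ∧ T₁ ≠ 0) →
          ∀ δ : ℤ, (δ = 1 ∨ δ = -1) → upqTypeClasses σK σ𝔤 hM.ad_compat 1 δ ≠ ⊥ →
            ∃ ξ : OneDimAutRepH L,
              MemXiFamily P (transpose_map_cmConjRingHom_eq_of_frame L ι H T hT) (isUnit_det_of_frame L ι H T hT) μω hμu ξ)
    : CohClassRoutingCotClosed₃ :=
  fun L _ _ _ ι H T hT hH hHd hdef h2 h3 μ _ μω hμu hμω _ _ μZ _ keys =>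
    cohClassRoutingCot_of_s2Fin₃ L H hH hHd μω hμu μZ keys ι T hT μ hFin₃ hdef h2 h3 hμω

/-! ## §3 FROM S2♯₃ (the text of the LH1 leaf's `S2SharpLetter₃` = ★ #80 body + the ONE `3 ≤ …` line, token for token) -/

/-- **`CohClassRoutingCot` FROM S2♯₃ (one frame with `3 ≤ [L⁺:ℚ]`).**  Hypothesis `hS2s₃` = the text of the LEAF's `S2SharpLetter₃` token for token (★ #80
`cohDiscrete_memXiFamily_archPinned` :100–:122 with ONE inserted `3 ≤ …` line: COROLLARY OF ★ #80 RESTRICTED TO THE TWO-COMPACT-PLACE FRAME — a ROUTE restriction, not an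
independently cited fact).  Proof = ★ `cohClassRoutingCot_of_s2sharp` :126–:128 re-threaded: S2♯₃ consumed at ONE frame (`hdef h2 h3`), its archimedean-pin conjunct dropped
(READ-BACK 1 `.memXiFamily` inlined as `.1`), then ★ `kcTrivial_of_isCot` ∕ ★ `cotSpherical` ∕ ★ `localRouting` as in §2.
[cite: Rogawski1990, §14.6 Thm. 14.6.4 (p. 246); §15.3 ¶1 (p. 249); Thm. 13.3.6 (c) (p. 202); §13.1 p. 199] [cite: FlathCorvallis1979, Thm. 3] -/
theorem cohClassRoutingCot_of_s2sharp₃ [∀ v : HeightOneSpectrum (𝓞 ↥(maximalRealSubfield L)), BorelSpace (Gqs L v ⧸ Subgroup.center (Gqs L v))]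
    [∀ v : HeightOneSpectrum (𝓞 ↥(maximalRealSubfield L)), (μZ v).IsHaarMeasure]
    (hS2s₃ : ∀ (L : Type) [Field L] [NumberField L] [IsCMField L] (ι : L →+* ℂ) (H : Matrix (Fin 3) (Fin 3) L) (T : GL (Fin 3) ℂ)
        (hT : (T : Matrix (Fin 3) (Fin 3) ℂ)ᴴ * H.map ι * (T : Matrix (Fin 3) (Fin 3) ℂ) = Literature.Geometry.ComplexHyperbolic.BallModel.J),
        (∀ τ' : L →+* ℂ, InfinitePlace.mk τ' ≠ InfinitePlace.mk ι → (H.map τ').PosDef) →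
        2 ≤ Module.finrank ℚ ↥(maximalRealSubfield L) →
        3 ≤ Module.finrank ℚ ↥(maximalRealSubfield L) →
        ∀ (μ : Measure (adelicGroupData (↥(maximalRealSubfield L)) L (IsCMField.complexConj L) 3 H).automorphicQuotient)
          [(adelicGroupData (↥(maximalRealSubfield L)) L (IsCMField.complexConj L) 3 H).IsAutomorphicMeasure μ]
          (μω : HeckeCharacter L) (hμu : μω.IsUnitary),
          (∀ x : Literature.NumberTheory.GaloisRepresentations.ideleGroup ↥(maximalRealSubfield L),
            μω (AdeleRing.ideleBaseChange (↥(maximalRealSubfield L)) L x) = quadraticHeckeCharCM L x) →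
        ∀ (P : DiscreteAutomorphicRep (adelicGroupData (↥(maximalRealSubfield L)) L (IsCMField.complexConj L) 3 H) μ),
              (P.IsHolCotangentAt (cmArchSection L ι H T hT) (cmCompactFactor L ι H T hT) ∨
                P.IsAntiholCotangentAt (cmArchSection L ι H T hT) (cmCompactFactor L ι H T hT)) →
              (∀ k : (adelicGroupData (↥(maximalRealSubfield L)) L (IsCMField.complexConj L) 3 H).Adelic, k ∈ cmCompactFactor L ι H T hT → ∀ v : P.space.toSubmodule, (adelicGroupData (↥(maximalRealSubfield L)) L (IsCMField.complexConj L) 3 H).rightRegular μ k (v : (adelicGroupData (↥(maximalRealSubfield L)) L (IsCMField.complexConj L) 3 H).L2 μ) = v) → ∀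
              (M : Type) [AddCommGroup M] [Module ℂ M]
              (σK : Representation ℂ (uFormGroup (Fin 2) (Fin 1)).maximalCompact M) (σ𝔤 : (uFormGroup (Fin 2) (Fin 1)).lie →ₗ⁅ℝ⁆ Module.End ℂ M)
              (hM : IsGKModule (uFormGroup (Fin 2) (Fin 1)) σK σ𝔤), IsIrreducibleGK σK σ𝔤 →
              (∃ T₁ : P.archModuleCM ι T hT →ₗ[ℂ] M,
                (∀ (k : (uFormGroup (Fin 2) (Fin 1)).maximalCompact) (w : P.archModuleCM ι T hT), T₁ (P.archRepKCM ι T hT k w) = σK k (T₁ w)) ∧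
                  (∀ (X : (uFormGroup (Fin 2) (Fin 1)).lie) (w : P.archModuleCM ι T hT), T₁ (P.archRepLieCM ι T hT X w) = σ𝔤 X (T₁ w)) ∧ T₁ ≠ 0) →
              ∀ δ : ℤ, (δ = 1 ∨ δ = -1) → upqTypeClasses σK σ𝔤 hM.ad_compat 1 δ ≠ ⊥ →
                ∃ ξ : OneDimAutRepH L, MemXiFamily P (transpose_map_cmConjRingHom_eq_of_frame L ι H T hT) (isUnit_det_of_frame L ι H T hT) μω hμu ξ ∧
                  ∀ k : InfinitePlace L → ℤ, μω.HasUnitaryArchType k (fun _ => 0) → ∀ ι' : L →+* ℂ, ξ.IsCohTrivialAt (ArchSignRecipe.tOfArchType k ι') ι')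
    (hdef : ∀ τ' : L →+* ℂ, InfinitePlace.mk τ' ≠ InfinitePlace.mk ι → (H.map τ').PosDef) (h2 : 2 ≤ Module.finrank ℚ ↥(maximalRealSubfield L))
    (h3 : 3 ≤ Module.finrank ℚ ↥(maximalRealSubfield L))
    (hμω : ∀ x : Literature.NumberTheory.GaloisRepresentations.ideleGroup ↥(maximalRealSubfield L),
      μω (AdeleRing.ideleBaseChange (↥(maximalRealSubfield L)) L x) = quadraticHeckeCharCM L x) :
    CohClassRoutingCot L H hH hHd μω hμu μZ keys ι T hT μ := by
  intro P hP M _ _ σK σ𝔤 hM hirr htok δ hδ hne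
  -- S2♯₃ at the ONE frame `hdef h2 h3`; the pin conjunct is not consumed on the `stub_L3` road
  obtain ⟨ξ, hmem, -⟩ := hS2s₃ L ι H T hT hdef h2 h3 μ μω hμu hμω P hP (kcTrivial_of_isCot L H ι T hT μ P hP) M σK σ𝔤 hM hirr htok δ hδ hne
  exact ⟨ξ, localRouting L H hH hHd μω hμu μZ keys μ P ξ hmem (cotSpherical L H ι T hT μ hdef h2 P hP)⟩

/-- **HEAD — `CohClassRoutingCotClosed₃` FROM THE LETTER S2♯₃ ALONE** (serves an AGG edition that keeps a registered `stub_S2sharp₃ : ‹S2SharpLetter₃›`).  Re-thread of ★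
`cohClassRoutingCotClosed_of_s2sharp` (:135) with `h3` after `h2`.  Axioms = TRIO. [cite: Rogawski1990, §14.6 Thm. 14.6.4 (p. 246); §15.3 ¶1 (p. 249); Thm. 13.3.6 (c) (p. 202)] [cite: FlathCorvallis1979, Thm. 3] -/
theorem cohClassRoutingCotClosed₃_of_s2sharp₃
    (hS2s₃ : ∀ (L : Type) [Field L] [NumberField L] [IsCMField L] (ι : L →+* ℂ) (H : Matrix (Fin 3) (Fin 3) L) (T : GL (Fin 3) ℂ)
        (hT : (T : Matrix (Fin 3) (Fin 3) ℂ)ᴴ * H.map ι * (T : Matrix (Fin 3) (Fin 3) ℂ) = Literature.Geometry.ComplexHyperbolic.BallModel.J),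
        (∀ τ' : L →+* ℂ, InfinitePlace.mk τ' ≠ InfinitePlace.mk ι → (H.map τ').PosDef) →
        2 ≤ Module.finrank ℚ ↥(maximalRealSubfield L) →
        3 ≤ Module.finrank ℚ ↥(maximalRealSubfield L) →
        ∀ (μ : Measure (adelicGroupData (↥(maximalRealSubfield L)) L (IsCMField.complexConj L) 3 H).automorphicQuotient)
          [(adelicGroupData (↥(maximalRealSubfield L)) L (IsCMField.complexConj L) 3 H).IsAutomorphicMeasure μ]
          (μω : HeckeCharacter L) (hμu : μω.IsUnitary),
          (∀ x : Literature.NumberTheory.GaloisRepresentations.ideleGroup ↥(maximalRealSubfield L),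
            μω (AdeleRing.ideleBaseChange (↥(maximalRealSubfield L)) L x) = quadraticHeckeCharCM L x) →
        ∀ (P : DiscreteAutomorphicRep (adelicGroupData (↥(maximalRealSubfield L)) L (IsCMField.complexConj L) 3 H) μ),
              (P.IsHolCotangentAt (cmArchSection L ι H T hT) (cmCompactFactor L ι H T hT) ∨
                P.IsAntiholCotangentAt (cmArchSection L ι H T hT) (cmCompactFactor L ι H T hT)) →
              (∀ k : (adelicGroupData (↥(maximalRealSubfield L)) L (IsCMField.complexConj L) 3 H).Adelic, k ∈ cmCompactFactor L ι H T hT → ∀ v : P.space.toSubmodule, (adelicGroupData (↥(maximalRealSubfield L)) L (IsCMField.complexConj L) 3 H).rightRegular μ k (v : (adelicGroupData (↥(maximalRealSubfield L)) L (IsCMField.complexConj L) 3 H).L2 μ) = v) → ∀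
              (M : Type) [AddCommGroup M] [Module ℂ M]
              (σK : Representation ℂ (uFormGroup (Fin 2) (Fin 1)).maximalCompact M) (σ𝔤 : (uFormGroup (Fin 2) (Fin 1)).lie →ₗ⁅ℝ⁆ Module.End ℂ M)
              (hM : IsGKModule (uFormGroup (Fin 2) (Fin 1)) σK σ𝔤), IsIrreducibleGK σK σ𝔤 →
              (∃ T₁ : P.archModuleCM ι T hT →ₗ[ℂ] M,
                (∀ (k : (uFormGroup (Fin 2) (Fin 1)).maximalCompact) (w : P.archModuleCM ι T hT), T₁ (P.archRepKCM ι T hT k w) = σK k (T₁ w)) ∧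
                  (∀ (X : (uFormGroup (Fin 2) (Fin 1)).lie) (w : P.archModuleCM ι T hT), T₁ (P.archRepLieCM ι T hT X w) = σ𝔤 X (T₁ w)) ∧ T₁ ≠ 0) →
              ∀ δ : ℤ, (δ = 1 ∨ δ = -1) → upqTypeClasses σK σ𝔤 hM.ad_compat 1 δ ≠ ⊥ →
                ∃ ξ : OneDimAutRepH L, MemXiFamily P (transpose_map_cmConjRingHom_eq_of_frame L ι H T hT) (isUnit_det_of_frame L ι H T hT) μω hμu ξ ∧
                  ∀ k : InfinitePlace L → ℤ, μω.HasUnitaryArchType k (fun _ => 0) → ∀ ι' : L →+* ℂ, ξ.IsCohTrivialAt (ArchSignRecipe.tOfArchType k ι') ι')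
    : CohClassRoutingCotClosed₃ :=
  fun L _ _ _ ι H T hT hH hHd hdef h2 h3 μ _ μω hμu hμω _ _ μZ _ keys =>
    cohClassRoutingCot_of_s2sharp₃ L H hH hHd μω hμu μZ keys ι T hT μ hS2s₃ hdef h2 h3 hμω

end Summit.HodgeConjecture.HodgeConjecture.Cruxes.H413.F0P3cCohClassRoutingCotClosed3

end
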